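import Summits.Ventures.PercRepro.Night2OneFatCaseOneMain

/-!
# PercRepro — the column bound of the good-target rule at targets with at most one coloop (night-2, gen 29)

`dload_gt_le_cap2_of_one_coloop`: the load of the rule `dshGT` at a one-coloop target with at least eight points off `K`
is at most its capacity `cap2` (from `sum_gtLoadAt_le_cap2_of_one_coloop` through `dload_gt_le_sum`);
`dload_gt_le_cap2_of_card_le_six`: a target with at most one coloop and at most six points off `K` has no source at all;
`dload_gt_le_cap2_of_card_coloops_le_one` combines them with the coloop-free case (`dload_gt_le_cap2_of_no_coloops`) —
the column bound of `dshGT` at every target with at most one coloop, except the one-coloop targets with exactly seven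
points off `K`.
-/

namespace PercRepro.Shadow

open Finset PerFlat ThmH

variable {α : Type*} [DecidableEq α] {M : Matroid α} [M.Finite] {G : Finset α}

section Column

open scoped Classical in
/-- **The column bound of `dshGT` at a one-coloop target with at least eight points off `K`.** -/
theorem dload_gt_le_cap2_of_one_coloop (hG : G ∈ flatsQ M (5 + 1)) (hd : (gr M \ G).card = 2)
    (hk : kColoops M G = 1) (hs : ∀ e ∈ gr M, ∀ f ∈ gr M, e ≠ f → rkN M {e, f} = 2)
    (hl : ∀ e ∈ gr M, M.Indep {e}) (hfat : (fatClosures M 5 G 2).card ≤ 1) {S : Finset α} (hSG : S ⊆ G)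
    (hKS : coloops M G ⊆ S) {w : α} (hc : coloops M (S \ coloops M G) = {w}) (h8 : 8 ≤ (S \ coloops M G).card) :
    dload M 5 G (bigP M G) (dshGT M 5 G) S ≤ cap2 M 5 G S :=
  (dload_gt_le_sum (P := bigP M G) hG (by omega) S).trans
    (sum_gtLoadAt_le_cap2_of_one_coloop hG hd hk hs hl hfat hSG hKS hc h8)

open scoped Classical in
/-- **A target with at most one coloop and at most six points off `K` has no source**: a lossy covering set `Q = S ∖ y`
has `|Q ∖ K| ≥ 6` (three coloops and a line of at least three points) and three coloops, so `y ∉ K` forces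
`|S ∖ K| ≥ 7` and `y ∈ K` forces `Q ∖ K = S ∖ K` with three coloops. -/
theorem dload_gt_le_cap2_of_card_le_six (hG : G ∈ flatsQ M (5 + 1)) (hd : (gr M \ G).card = 2)
    (hk : kColoops M G = 1) (hs : ∀ e ∈ gr M, ∀ f ∈ gr M, e ≠ f → rkN M {e, f} = 2)
    (hl : ∀ e ∈ gr M, M.Indep {e}) {S : Finset α} (hSG : S ⊆ G) (hc1 : (coloops M (S \ coloops M G)).card ≤ 1)
    (h6 : (S \ coloops M G).card ≤ 6) : dload M 5 G (bigP M G) (dshGT M 5 G) S ≤ cap2 M 5 G S := by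
  have hd' : (gr M \ G).card ≤ 5 := by omega
  have hcapS := capS_ge_eleven_eighteenths_two_one hd hk hSG
  have hcap2 := cap2_ge_capS_sub_L1_of_le hG hd' S
  have hL1S := L1_le_of_card_coloops_le_one hG hd hc1
  have h1 := dload_gt_le_sum (P := bigP M G) hG hd' S
  have h2 : ∑ y ∈ S, gtLoadAt M 5 G (bigP M G) (S.erase y) y = 0 := by
    apply Finset.sum_eq_zero
    intro y hyS
    apply gtLoadAt_eq_zero_of_faceLossP_eq_zero
    intro w' hw'
    by_contra h0
    obtain ⟨-, -, hC3, -, -, hR3⟩ := lossy_structure_of_faceLossP_ne_zero hG hd hk hs hl hw' h0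
    have hCsub : coloops M (S.erase y \ coloops M G) ⊆ S.erase y \ coloops M G := fun a ha => (mem_coloops.1 ha).1
    have hQ6 : 6 ≤ (S.erase y \ coloops M G).card := by
      have := Finset.card_sdiff_add_card_eq_card hCsub
      omega
    by_cases hyK : y ∈ coloops M G
    · -- `Q ∖ K = S ∖ K`, which has at most one coloop
      have hQV : S.erase y \ coloops M G = S \ coloops M G := by
        ext a
        simp only [Finset.mem_sdiff, Finset.mem_erase]
        constructor
        · rintro ⟨⟨-, ha⟩, haK⟩; exact ⟨ha, haK⟩
        · rintro ⟨ha, haK⟩; exact ⟨⟨fun h => haK (h ▸ hyK), ha⟩, haK⟩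
      rw [hQV] at hC3
      omega
    · -- `Q ∖ K = (S ∖ K) ∖ y`
      have hQV : S.erase y \ coloops M G ⊆ S \ coloops M G := fun a ha =>
        Finset.mem_sdiff.2 ⟨Finset.mem_of_mem_erase (Finset.mem_sdiff.1 ha).1, (Finset.mem_sdiff.1 ha).2⟩
      have hyV : y ∈ S \ coloops M G := Finset.mem_sdiff.2 ⟨hyS, hyK⟩
      have hy' : y ∉ S.erase y \ coloops M G := fun h => (Finset.mem_erase.1 (Finset.mem_sdiff.1 h).1).1 rfl
      have hlt := Finset.card_lt_card (Finset.ssubset_iff_of_subset hQV |>.2 ⟨y, hyV, hy'⟩)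
      omega
  rw [h2] at h1
  linarith

open scoped Classical in
/-- **The column bound of `dshGT` at a target with at most one coloop**, except a one-coloop target with exactly seven
points off `K`: coloop-free targets (`dload_gt_le_cap2_of_no_coloops`), one-coloop targets with at most six points (no
source) and with at least eight points (`dload_gt_le_cap2_of_one_coloop`). -/
theorem dload_gt_le_cap2_of_card_coloops_le_one (hG : G ∈ flatsQ M (5 + 1)) (hd : (gr M \ G).card = 2)
    (hk : kColoops M G = 1) (hs : ∀ e ∈ gr M, ∀ f ∈ gr M, e ≠ f → rkN M {e, f} = 2)
    (hl : ∀ e ∈ gr M, M.Indep {e}) (hfat : (fatClosures M 5 G 2).card ≤ 1) {S : Finset α} (hSG : S ⊆ G)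
    (hKS : coloops M G ⊆ S) (hc1 : (coloops M (S \ coloops M G)).card ≤ 1)
    (h7 : (coloops M (S \ coloops M G)).card = 1 → (S \ coloops M G).card ≠ 7) :
    dload M 5 G (bigP M G) (dshGT M 5 G) S ≤ cap2 M 5 G S := by
  rcases Nat.le_one_iff_eq_zero_or_eq_one.1 hc1 with h0 | h1
  · exact dload_gt_le_cap2_of_no_coloops hG hd hk hs hl hfat hSG (Finset.card_eq_zero.1 h0)
  · obtain ⟨w, hw⟩ := Finset.card_eq_one.1 h1
    by_cases h6 : (S \ coloops M G).card ≤ 6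
    · exact dload_gt_le_cap2_of_card_le_six hG hd hk hs hl hSG hc1 h6
    · exact dload_gt_le_cap2_of_one_coloop hG hd hk hs hl hfat hSG hKS hw (by have := h7 h1; omega)

end Column

end PercRepro.Shadow
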